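import Summits.Ventures.LatticeQCDFlow.Scoring.U1TorusPlaquetteMomentBounds
import Summits.Ventures.LatticeQCDFlow.Scoring.U1TorusVarianceIntervalArithmetic
import Summits.Ventures.LatticeQCDFlow.Scoring.U1TorusPlaquetteCertificate
import Summits.Ventures.LatticeQCDFlow.Scoring.U1TorusPlaquetteAverageVariance
import Summits.Ventures.LatticeQCDFlow.Scoring.U1TorusPlaquetteEnclosures
import HarnessLib

/-!
# A rational certificate for the variance of the volume-averaged plaquette of the 2-d `U(1)` torus

HONEST FRAMING: exact (Metropolis-corrected) sampling algorithms for lattice gauge theory;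
figures of merit are autocorrelation/cost numbers at stated couplings and volumes; no
continuum-physics claim.

Venture `LatticeQCDFlow` (cell pub-lqcd), sub-topic `Scoring`; FANOUT row 5 (`s0-sun-a`), GEN-13.
NEW WORK of the cell (placement rule).  `Scoring/U1TorusPlaquetteAverageVariance.lean` (GEN-13) proves
`Var(P̄)_{L₁×L₂,β} = (S/Z)/V + (1 − 1/V)(P/Z) − (N/Z)²` for the volume-averaged plaquette of the 2-d `U(1)`
torus (`Z = Σ_k I_{|k|}^V`, `N = Σ_k I_{|k|}^{V−1}I_k'`, `P = Σ_k I_{|k|}^{V−2}(I_k')²`, `S = Σ_k I_{|k|}^{V−1}I_k''`).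
This file extends GEN-8's plaquette certificate (`Scoring/U1TorusPlaquetteCertificate.lean`) to that
variance:

* §1 **`torus_moment_units`** — from `a ≤ I₁/I₀ ≤ b`, `e^β ≤ E` and the recurrence letters
  `c = 1 − 2b/β`, `d = 1 − 2a/β`, `e = a − 4d/β`, `f = b − 4c/β`, `g = d − 6e/β`, `M = max f g`
  (`I₂ = I₀ − 2I₁/β`, …; `max(I₃,I₄) ≤ M I₀` bounds every `I_k`, `|k| ≥ 3`), the central terms
  (`Scoring/U1TorusVarianceIntervalArithmetic.lean`) and the tails (`Scoring/U1TorusPlaquetteBounds.lean`,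
  `Scoring/U1TorusPlaquetteMomentBounds.lean`): `I₀^V·X_lo ≤ X ≤ I₀^V·X_hi` for `X ∈ {Z, N, P, S}`, `V = W + 3`;
* §2 **`torusVariance_mem_Icc_of_check`** — the certificate: GEN-5's `u1Check β a b K = true` and a
  kernel-decidable Boolean conjunction of rational inequalities (the letters above;
  `lo ≤ S_lo/(V Z_hi) + (1−1/V)P_lo/Z_hi − (N_hi/Z_lo)²`, `S_hi/(V Z_lo) + (1−1/V)P_hi/Z_lo − (N_lo/Z_hi)² ≤ hi`;
  written as a `let … ; decide … && …` TERM, so that the file declares no `def`), with `0 < β`, `3 ≤ V`,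
  `e^β ≤ E`, imply `lo ≤ (S/Z)/V + (1 − 1/V)(P/Z) − (N/Z)² ≤ hi`;
* §3 **`torus16_variance_encl_of_check`** — the same two checks at `β = m + 1`, `E = 2.719^{m+1}`,
  `V = 16·16` enclose `Var(P̄)_{16×16,β} = ⟨P̄²⟩ − ⟨P̄⟩²` of `Scoring/U1TorusPlaquetteAverageVariance.lean`.

The instances at the S0-B keys (`β = 1,…,7`) are `Scoring/U1TorusPlaquetteVarianceEnclosures.lean`.
Elementary; nothing is cited; no `def`.
-/

noncomputable section

open Real Finset
open scoped Nat
open Literature.Analysis.FunctionSpaces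

namespace Summit.Ventures.LatticeQCDFlow.Scoring

/-! ### 1. Two-sided bounds for `Z, N, P, S` in units of `I₀^V` -/

/-- **Units bounds.**  `β > 0`, `V = W + 3`; `a ≤ I₁/I₀ ≤ b`, `e^β ≤ E`, the letters
`c = 1 − 2b/β`, `d = 1 − 2a/β`, `e = a − 4d/β`, `f = b − 4c/β`, `g = d − 6e/β`, `M = max f g` with
`0 < a`, `0 ≤ c`, `0 ≤ e`.  Then, writing `I = I₀(β)^V`, in order:
`I(1+2a^V+2c^V) ≤ Z ≤ I(1+2b^V+2d^V+M^{V−1}E)`, `I·N_lo ≤ N ≤ I·N_hi`, `I·P_lo ≤ P ≤ I·P_hi`,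
`I·S_lo ≤ S ≤ I·S_hi` with the polynomials of `torusVarCheck`. -/
theorem torus_moment_units {β : ℝ} (hβ : 0 < β) (W : ℕ) {a b c d e f g M E : ℝ}
    (hab : a ≤ besselI 1 β / besselI 0 β) (hba : besselI 1 β / besselI 0 β ≤ b)
    (hE : Real.exp β ≤ E) (hc : c = 1 - 2 * b / β) (hd : d = 1 - 2 * a / β)
    (he : e = a - 4 * d / β) (hf : f = b - 4 * c / β) (hg : g = d - 6 * e / β) (hM : M = max f g)
    (h0a : 0 < a) (h0c : 0 ≤ c) (h0e : 0 ≤ e) :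
    (besselI 0 β ^ (W + 3) * (1 + 2 * a ^ (W + 3) + 2 * c ^ (W + 3)) ≤
        ∑' k : ℤ, besselI k.natAbs β ^ (W + 3)) ∧
    (∑' k : ℤ, besselI k.natAbs β ^ (W + 3) ≤
        besselI 0 β ^ (W + 3) * (1 + 2 * b ^ (W + 3) + 2 * d ^ (W + 3) + M ^ (W + 2) * E)) ∧
    (besselI 0 β ^ (W + 3) * (a + a ^ (W + 2) * (1 + c) + c ^ (W + 2) * (a + e)) ≤
        ∑' k : ℤ, besselI k.natAbs β ^ (W + 2) *
          ((besselI (k - 1).natAbs β + besselI (k + 1).natAbs β) / 2)) ∧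
    (∑' k : ℤ, besselI k.natAbs β ^ (W + 2) *
          ((besselI (k - 1).natAbs β + besselI (k + 1).natAbs β) / 2) ≤
        besselI 0 β ^ (W + 3) * (b + b ^ (W + 2) * (1 + d) + d ^ (W + 2) * (b + f) + M ^ (W + 1) * E)) ∧
    (besselI 0 β ^ (W + 3) *
          (a ^ 2 + 2 * a ^ (W + 1) * ((1 + c) / 2) ^ 2 + 2 * c ^ (W + 1) * ((a + e) / 2) ^ 2) ≤
        ∑' k : ℤ, besselI k.natAbs β ^ (W + 1) *
          ((besselI (k - 1).natAbs β + besselI (k + 1).natAbs β) / 2) ^ 2) ∧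
    (∑' k : ℤ, besselI k.natAbs β ^ (W + 1) *
          ((besselI (k - 1).natAbs β + besselI (k + 1).natAbs β) / 2) ^ 2 ≤
        besselI 0 β ^ (W + 3) * (b ^ 2 + 2 * b ^ (W + 1) * ((1 + d) / 2) ^ 2 +
          2 * d ^ (W + 1) * ((b + f) / 2) ^ 2 + M ^ W * E)) ∧
    (besselI 0 β ^ (W + 3) *
          ((1 + c) / 2 + 2 * a ^ (W + 2) * ((3 * a + e) / 4) + 2 * c ^ (W + 2) * ((1 + 2 * c) / 4)) ≤
        ∑' k : ℤ, besselI k.natAbs β ^ (W + 2) *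
          ((besselI (k - 2).natAbs β + 2 * besselI k.natAbs β + besselI (k + 2).natAbs β) / 4)) ∧
    (∑' k : ℤ, besselI k.natAbs β ^ (W + 2) *
          ((besselI (k - 2).natAbs β + 2 * besselI k.natAbs β + besselI (k + 2).natAbs β) / 4) ≤
        besselI 0 β ^ (W + 3) * ((1 + d) / 2 + 2 * b ^ (W + 2) * ((3 * b + f) / 4) +
          2 * d ^ (W + 2) * ((1 + 2 * d + g) / 4) + M ^ (W + 1) * E)) := by
  have hβ0 : β ≠ 0 := hβ.ne'
  set I0 := besselI 0 β with hI0def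
  set I1 := besselI 1 β with hI1def
  have hI0 : 0 < I0 := besselI_pos 0 hβ
  have hI0' : 1 ≤ I0 := one_le_besselI_zero β
  have hI1 : 0 < I1 := besselI_pos 1 hβ
  have hI2p : 0 < besselI 2 β := besselI_pos 2 hβ
  have hI3p : 0 < besselI 3 β := besselI_pos 3 hβ
  have hI4p : 0 < besselI 4 β := besselI_pos 4 hβ
  have h1lo : a * I0 ≤ I1 := by rwa [le_div_iff₀ hI0] at hab
  have h1hi : I1 ≤ b * I0 := by rwa [div_le_iff₀ hI0] at hba
  have h2eq : besselI 2 β = I0 - 2 / β * I1 := by rw [besselI_two_eq hβ0]; ring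
  have h3eq : besselI 3 β = I1 - 4 / β * besselI 2 β := by rw [besselI_three_eq hβ0]; ring
  have h4eq : besselI 4 β = besselI 2 β - 6 / β * besselI 3 β := by rw [besselI_four_eq hβ0]; ring
  have h2β : (0 : ℝ) ≤ 2 / β := by positivity
  have h4β : (0 : ℝ) ≤ 4 / β := by positivity
  have h6β : (0 : ℝ) ≤ 6 / β := by positivity
  have h2lo : c * I0 ≤ besselI 2 β := by
    rw [h2eq, hc, show (1 - 2 * b / β) * I0 = I0 - 2 / β * (b * I0) by ring]
    linarith [mul_le_mul_of_nonneg_left h1hi h2β]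
  have h2hi : besselI 2 β ≤ d * I0 := by
    rw [h2eq, hd, show (1 - 2 * a / β) * I0 = I0 - 2 / β * (a * I0) by ring]
    linarith [mul_le_mul_of_nonneg_left h1lo h2β]
  have h3lo : e * I0 ≤ besselI 3 β := by
    rw [h3eq, he, show (a - 4 * d / β) * I0 = a * I0 - 4 / β * (d * I0) by ring]
    linarith [mul_le_mul_of_nonneg_left h2hi h4β]
  have h3hi : besselI 3 β ≤ f * I0 := by
    rw [h3eq, hf, show (b - 4 * c / β) * I0 = b * I0 - 4 / β * (c * I0) by ring]
    linarith [mul_le_mul_of_nonneg_left h2lo h4β]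
  have h4hi : besselI 4 β ≤ g * I0 := by
    rw [h4eq, hg, show (d - 6 * e / β) * I0 = d * I0 - 6 / β * (e * I0) by ring]
    linarith [mul_le_mul_of_nonneg_left h3lo h6β]
  -- `m = max(I₃, I₄) ≤ M·I₀`
  set m := max (besselI 3 β) (besselI 4 β) with hm
  have hm0 : 0 ≤ m := hI3p.le.trans (le_max_left _ _)
  have hmM : m ≤ M * I0 := by
    rw [hM, max_mul_of_nonneg _ _ hI0.le]
    exact max_le_max h3hi h4hi
  have hM0 : 0 ≤ M := le_of_mul_le_mul_right (by linarith : 0 * I0 ≤ M * I0) hI0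
  have hE0 : 0 ≤ E := (Real.exp_pos β).le.trans hE
  -- central terms
  obtain ⟨cZ1, cZ2, cN1, cN2, cP1, cP2, cS1, cS2⟩ := central_units_bounds W hI0.le hI1.le hI2p.le
    hI3p.le hI4p.le h0a.le h0c h0e h1lo h1hi h2lo h2hi h3lo h3hi h4hi
  -- splitting the four sums
  have hZsplit := (summable_besselI_natAbs_pow hβ (V := W + 3) (by omega)).sum_add_tsum_subtype_compl
    centralCharges
  have hNsplit := (summable_torusN_term hβ (V := W + 3) (by omega)).sum_add_tsum_subtype_compl
    centralCharges
  have hPsplit := (summable_torusP_term hβ (V := W + 3) (by omega)).sum_add_tsum_subtype_compl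
    centralCharges
  have hSsplit := (summable_torusS_term hβ (V := W + 3) (by omega)).sum_add_tsum_subtype_compl
    centralCharges
  rw [torusZ_central] at hZsplit
  rw [torusN_central] at hNsplit
  rw [torusP_central] at hPsplit
  rw [torusS_central] at hSsplit
  obtain ⟨hZt0, hZt1⟩ := torusZ_tail_bounds hβ (V := W + 3) (by omega)
  obtain ⟨hNt0, hNt1⟩ := torusN_tail_bounds hβ (V := W + 3) (by omega)
  obtain ⟨hPt0, hPt1⟩ := torusP_tail_bounds hβ (V := W + 3) (by omega)
  obtain ⟨hSt0, hSt1⟩ := torusS_tail_bounds hβ (V := W + 3) (by omega)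
  rw [← hm] at hZt1 hNt1 hPt1 hSt1
  simp only [show W + 3 - 1 = W + 2 from rfl, show W + 3 - 2 = W + 1 from rfl,
    show W + 3 - 3 = W from rfl] at *
  rw [← hZsplit, ← hNsplit, ← hPsplit, ← hSsplit]
  -- powers of `I₀`
  have hI0pow1 : I0 ^ (W + 2) ≤ I0 ^ (W + 3) := pow_le_pow_right₀ hI0' (by omega)
  have hmMpow : ∀ j : ℕ, m ^ j ≤ M ^ j * I0 ^ j := fun j => by
    rw [← mul_pow]; exact pow_le_pow_left₀ hm0 hmM j
  -- tails in units of `I₀^V`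
  have hZt2 : ∑' k : {k : ℤ // k ∉ centralCharges}, besselI k.1.natAbs β ^ (W + 3) ≤
      I0 ^ (W + 3) * (M ^ (W + 2) * E) := by
    calc _ ≤ m ^ (W + 2) * Real.exp β := hZt1
      _ ≤ M ^ (W + 2) * I0 ^ (W + 2) * E :=
          mul_le_mul (hmMpow _) hE (Real.exp_pos β).le (by positivity)
      _ ≤ M ^ (W + 2) * I0 ^ (W + 3) * E := by gcongr
      _ = _ := by ring
  have hNt2 : ∑' k : {k : ℤ // k ∉ centralCharges}, besselI k.1.natAbs β ^ (W + 2) *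
        ((besselI (k.1 - 1).natAbs β + besselI (k.1 + 1).natAbs β) / 2) ≤
      I0 ^ (W + 3) * (M ^ (W + 1) * E) := by
    calc _ ≤ m ^ (W + 1) * I0 * Real.exp β := hNt1
      _ ≤ M ^ (W + 1) * I0 ^ (W + 1) * I0 * E :=
          mul_le_mul (mul_le_mul_of_nonneg_right (hmMpow _) hI0.le) hE (Real.exp_pos β).le
            (by positivity)
      _ = M ^ (W + 1) * I0 ^ (W + 2) * E := by ring
      _ ≤ M ^ (W + 1) * I0 ^ (W + 3) * E := by gcongr
      _ = _ := by ring
  have hPt2 : ∑' k : {k : ℤ // k ∉ centralCharges}, besselI k.1.natAbs β ^ (W + 1) *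
        ((besselI (k.1 - 1).natAbs β + besselI (k.1 + 1).natAbs β) / 2) ^ 2 ≤
      I0 ^ (W + 3) * (M ^ W * E) := by
    calc _ ≤ m ^ W * I0 ^ 2 * Real.exp β := hPt1
      _ ≤ M ^ W * I0 ^ W * I0 ^ 2 * E :=
          mul_le_mul (mul_le_mul_of_nonneg_right (hmMpow _) (by positivity)) hE
            (Real.exp_pos β).le (by positivity)
      _ = M ^ W * I0 ^ (W + 2) * E := by ring
      _ ≤ M ^ W * I0 ^ (W + 3) * E := by gcongr
      _ = _ := by ring
  have hSt2 : ∑' k : {k : ℤ // k ∉ centralCharges}, besselI k.1.natAbs β ^ (W + 2) *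
        ((besselI (k.1 - 2).natAbs β + 2 * besselI k.1.natAbs β + besselI (k.1 + 2).natAbs β) / 4) ≤
      I0 ^ (W + 3) * (M ^ (W + 1) * E) := by
    calc _ ≤ m ^ (W + 1) * I0 * Real.exp β := hSt1
      _ ≤ M ^ (W + 1) * I0 ^ (W + 1) * I0 * E :=
          mul_le_mul (mul_le_mul_of_nonneg_right (hmMpow _) hI0.le) hE (Real.exp_pos β).le
            (by positivity)
      _ = M ^ (W + 1) * I0 ^ (W + 2) * E := by ring
      _ ≤ M ^ (W + 1) * I0 ^ (W + 3) * E := by gcongr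
      _ = _ := by ring
  refine ⟨?_, ?_, ?_, ?_, ?_, ?_, ?_, ?_⟩
  · linarith
  · rw [show I0 ^ (W + 3) * (1 + 2 * b ^ (W + 3) + 2 * d ^ (W + 3) + M ^ (W + 2) * E) =
      I0 ^ (W + 3) * (1 + 2 * b ^ (W + 3) + 2 * d ^ (W + 3)) + I0 ^ (W + 3) * (M ^ (W + 2) * E) by ring]
    linarith
  · linarith
  · rw [show I0 ^ (W + 3) * (b + b ^ (W + 2) * (1 + d) + d ^ (W + 2) * (b + f) + M ^ (W + 1) * E) =
      I0 ^ (W + 3) * (b + b ^ (W + 2) * (1 + d) + d ^ (W + 2) * (b + f)) +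
        I0 ^ (W + 3) * (M ^ (W + 1) * E) by ring]
    linarith
  · linarith
  · rw [show I0 ^ (W + 3) * (b ^ 2 + 2 * b ^ (W + 1) * ((1 + d) / 2) ^ 2 +
        2 * d ^ (W + 1) * ((b + f) / 2) ^ 2 + M ^ W * E) =
      I0 ^ (W + 3) * (b ^ 2 + 2 * b ^ (W + 1) * ((1 + d) / 2) ^ 2 + 2 * d ^ (W + 1) * ((b + f) / 2) ^ 2) +
        I0 ^ (W + 3) * (M ^ W * E) by ring]
    linarith
  · linarith
  · rw [show I0 ^ (W + 3) * ((1 + d) / 2 + 2 * b ^ (W + 2) * ((3 * b + f) / 4) +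
        2 * d ^ (W + 2) * ((1 + 2 * d + g) / 4) + M ^ (W + 1) * E) =
      I0 ^ (W + 3) * ((1 + d) / 2 + 2 * b ^ (W + 2) * ((3 * b + f) / 4) +
        2 * d ^ (W + 2) * ((1 + 2 * d + g) / 4)) + I0 ^ (W + 3) * (M ^ (W + 1) * E) by ring]
    linarith

/-! ### 2. The certificate and its soundness (no `def`: the check is a kernel-decidable term) -/

/-- **Soundness of the variance certificate.**  If GEN-5's `u1Check β a b K = true` (`a ≤ I₁/I₀ ≤ b`),
the Boolean conjunction of rational inequalities below evaluates to `true` (letters `c,…,M` and the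
eight units polynomials of `torus_moment_units`), `0 < β`, `3 ≤ V` and `e^β ≤ E`, then
`lo ≤ (S/Z)/V + (1 − 1/V)(P/Z) − (N/Z)² ≤ hi` for the exact torus sums with `V` plaquettes. -/
theorem torusVariance_mem_Icc_of_check {β a b E lo hi : ℚ} {K V : ℕ} (hV : 3 ≤ V)
    (hu : u1Check β a b K = true)
    (hr : ((let c : ℚ := 1 - 2 * b / β
        let d : ℚ := 1 - 2 * a / β
        let e : ℚ := a - 4 * d / β
        let f : ℚ := b - 4 * c / β
        let g : ℚ := d - 6 * e / β
        let M : ℚ := max f g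
        let Zl : ℚ := 1 + 2 * a ^ V + 2 * c ^ V
        let Zh : ℚ := 1 + 2 * b ^ V + 2 * d ^ V + M ^ (V - 1) * E
        let Nl : ℚ := a + a ^ (V - 1) * (1 + c) + c ^ (V - 1) * (a + e)
        let Nh : ℚ := b + b ^ (V - 1) * (1 + d) + d ^ (V - 1) * (b + f) + M ^ (V - 2) * E
        let Pl : ℚ := a ^ 2 + 2 * a ^ (V - 2) * ((1 + c) / 2) ^ 2 + 2 * c ^ (V - 2) * ((a + e) / 2) ^ 2
        let Ph : ℚ := b ^ 2 + 2 * b ^ (V - 2) * ((1 + d) / 2) ^ 2 + 2 * d ^ (V - 2) * ((b + f) / 2) ^ 2 +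
          M ^ (V - 3) * E
        let Sl : ℚ := (1 + c) / 2 + 2 * a ^ (V - 1) * ((3 * a + e) / 4) +
          2 * c ^ (V - 1) * ((1 + 2 * c) / 4)
        let Sh : ℚ := (1 + d) / 2 + 2 * b ^ (V - 1) * ((3 * b + f) / 4) +
          2 * d ^ (V - 1) * ((1 + 2 * d + g) / 4) + M ^ (V - 2) * E
        decide (0 < a) && decide (0 ≤ c) && decide (0 ≤ e) &&
          decide (lo ≤ Sl / ((V : ℚ) * Zh) + (1 - 1 / (V : ℚ)) * (Pl / Zh) - (Nh / Zl) ^ 2) &&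
          decide (Sh / ((V : ℚ) * Zl) + (1 - 1 / (V : ℚ)) * (Ph / Zl) - (Nl / Zh) ^ 2 ≤ hi) : Bool) = true))
    (hβ : (0 : ℝ) < ((β : ℚ) : ℝ)) (hE : Real.exp ((β : ℚ) : ℝ) ≤ ((E : ℚ) : ℝ)) :
    ((lo : ℚ) : ℝ) ≤
      (∑' k : ℤ, besselI k.natAbs ((β : ℚ) : ℝ) ^ (V - 1) *
            ((besselI (k - 2).natAbs ((β : ℚ) : ℝ) + 2 * besselI k.natAbs ((β : ℚ) : ℝ) +
              besselI (k + 2).natAbs ((β : ℚ) : ℝ)) / 4)) /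
          (∑' k : ℤ, besselI k.natAbs ((β : ℚ) : ℝ) ^ V) / ((V : ℕ) : ℝ) +
        (1 - 1 / ((V : ℕ) : ℝ)) *
          ((∑' k : ℤ, besselI k.natAbs ((β : ℚ) : ℝ) ^ (V - 2) *
              ((besselI (k - 1).natAbs ((β : ℚ) : ℝ) + besselI (k + 1).natAbs ((β : ℚ) : ℝ)) / 2) ^ 2) /
            ∑' k : ℤ, besselI k.natAbs ((β : ℚ) : ℝ) ^ V) -
        ((∑' k : ℤ, besselI k.natAbs ((β : ℚ) : ℝ) ^ (V - 1) *
            ((besselI (k - 1).natAbs ((β : ℚ) : ℝ) + besselI (k + 1).natAbs ((β : ℚ) : ℝ)) / 2)) /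
          ∑' k : ℤ, besselI k.natAbs ((β : ℚ) : ℝ) ^ V) ^ 2 ∧
    (∑' k : ℤ, besselI k.natAbs ((β : ℚ) : ℝ) ^ (V - 1) *
            ((besselI (k - 2).natAbs ((β : ℚ) : ℝ) + 2 * besselI k.natAbs ((β : ℚ) : ℝ) +
              besselI (k + 2).natAbs ((β : ℚ) : ℝ)) / 4)) /
          (∑' k : ℤ, besselI k.natAbs ((β : ℚ) : ℝ) ^ V) / ((V : ℕ) : ℝ) +
        (1 - 1 / ((V : ℕ) : ℝ)) *
          ((∑' k : ℤ, besselI k.natAbs ((β : ℚ) : ℝ) ^ (V - 2) *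
              ((besselI (k - 1).natAbs ((β : ℚ) : ℝ) + besselI (k + 1).natAbs ((β : ℚ) : ℝ)) / 2) ^ 2) /
            ∑' k : ℤ, besselI k.natAbs ((β : ℚ) : ℝ) ^ V) -
        ((∑' k : ℤ, besselI k.natAbs ((β : ℚ) : ℝ) ^ (V - 1) *
            ((besselI (k - 1).natAbs ((β : ℚ) : ℝ) + besselI (k + 1).natAbs ((β : ℚ) : ℝ)) / 2)) /
          ∑' k : ℤ, besselI k.natAbs ((β : ℚ) : ℝ) ^ V) ^ 2 ≤ ((hi : ℚ) : ℝ) := by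
  obtain ⟨W, rfl⟩ := Nat.exists_eq_add_of_le' hV
  simp only [Bool.and_eq_true, decide_eq_true_eq] at hr
  obtain ⟨⟨⟨⟨h0a, h0c⟩, h0e⟩, hlo⟩, hhi⟩ := hr
  have hab := u1Check_sound hu
  rw [onePlaquetteExpect_cos_eq_besselI_div] at hab
  set βr : ℝ := ((β : ℚ) : ℝ) with hβr
  -- the letters, as reals
  set c : ℝ := ((1 - 2 * b / β : ℚ) : ℝ) with hc
  set d : ℝ := ((1 - 2 * a / β : ℚ) : ℝ) with hd
  set e : ℝ := ((a - 4 * (1 - 2 * a / β) / β : ℚ) : ℝ) with he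
  set f : ℝ := ((b - 4 * (1 - 2 * b / β) / β : ℚ) : ℝ) with hf
  set g : ℝ := (((1 - 2 * a / β) - 6 * (a - 4 * (1 - 2 * a / β) / β) / β : ℚ) : ℝ) with hg
  set M : ℝ := ((max (b - 4 * (1 - 2 * b / β) / β)
    ((1 - 2 * a / β) - 6 * (a - 4 * (1 - 2 * a / β) / β) / β) : ℚ) : ℝ) with hM
  obtain ⟨hZ1, hZ2, hN1, hN2, hP1, hP2, hS1, hS2⟩ := torus_moment_units hβ W hab.1 hab.2 hE
    (a := ((a : ℚ) : ℝ)) (b := ((b : ℚ) : ℝ)) (c := c) (d := d) (e := e) (f := f) (g := g) (M := M)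
    (by rw [hc]; push_cast; ring) (by rw [hd]; push_cast; ring) (by rw [he, hd]; push_cast; ring)
    (by rw [hf, hc]; push_cast; ring) (by rw [hg, hd, he]; push_cast; ring)
    (by rw [hM, hf, hg]; push_cast; rfl) (by exact_mod_cast h0a) (by rw [hc]; exact_mod_cast h0c)
    (by rw [he]; exact_mod_cast h0e)
  have hI : (0 : ℝ) < besselI 0 βr ^ (W + 3) := pow_pos (besselI_pos 0 hβ) _
  have h0a' : (0 : ℝ) < ((a : ℚ) : ℝ) := by exact_mod_cast h0a
  have h0c' : (0 : ℝ) ≤ c := by rw [hc]; exact_mod_cast h0c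
  have h0e' : (0 : ℝ) ≤ e := by rw [he]; exact_mod_cast h0e
  have hV1 : (1 : ℝ) ≤ ((W + 3 : ℕ) : ℝ) := by exact_mod_cast (by omega : 1 ≤ W + 3)
  have key := variance_mem_Icc_of_units (V := ((W + 3 : ℕ) : ℝ)) hI hV1
    (by positivity : (0 : ℝ) < 1 + 2 * ((a : ℚ) : ℝ) ^ (W + 3) + 2 * c ^ (W + 3))
    (by positivity : (0 : ℝ) ≤ ((a : ℚ) : ℝ) + ((a : ℚ) : ℝ) ^ (W + 2) * (1 + c) + c ^ (W + 2) *
      (((a : ℚ) : ℝ) + e))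
    (by positivity : (0 : ℝ) ≤ ((a : ℚ) : ℝ) ^ 2 + 2 * ((a : ℚ) : ℝ) ^ (W + 1) * ((1 + c) / 2) ^ 2 +
      2 * c ^ (W + 1) * ((((a : ℚ) : ℝ) + e) / 2) ^ 2)
    (by positivity : (0 : ℝ) ≤ (1 + c) / 2 + 2 * ((a : ℚ) : ℝ) ^ (W + 2) * ((3 * ((a : ℚ) : ℝ) + e) / 4) +
      2 * c ^ (W + 2) * ((1 + 2 * c) / 4))
    hZ1 hZ2 hN1 hN2 hP1 hP2 hS1 hS2
  simp only [show W + 3 - 1 = W + 2 from rfl, show W + 3 - 2 = W + 1 from rfl]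
  obtain ⟨k1, k2⟩ := key
  constructor
  · refine le_trans ?_ k1
    have h1 := (Rat.cast_le (K := ℝ)).mpr hlo
    simp only [show W + 3 - 1 = W + 2 from rfl, show W + 3 - 2 = W + 1 from rfl] at h1
    simp only [hc, hd, he, hf, hM]
    push_cast at h1 ⊢
    linarith
  · refine le_trans k2 ?_
    have h1 := (Rat.cast_le (K := ℝ)).mpr hhi
    simp only [show W + 3 - 1 = W + 2 from rfl, show W + 3 - 2 = W + 1 from rfl,
      show W + 3 - 3 = W from rfl] at h1
    simp only [hc, hd, he, hf, hg, hM]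
    push_cast at h1 ⊢
    linarith

/-! ### 3. The `16 × 16` torus at natural `β` -/

section Torus16

variable {n : ℕ} (e : Fin 2 × (Fin 16 × Fin 16) ≃ Fin (n + 1))

/-- **Common shape of the S0-B instances**: the two checks for natural `β = m + 1` with
`E = 2.719^{m+1}`, `V = 16·16` enclose `Var(P̄)_{16×16,β} = ⟨P̄²⟩ − ⟨P̄⟩²`. -/
theorem torus16_variance_encl_of_check {m : ℕ} {a b lo hi : ℚ} {K : ℕ}
    (hu : u1Check (m + 1 : ℕ) a b K = true)
    (hr : ((let c : ℚ := 1 - 2 * b / ((m + 1 : ℕ) : ℚ)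
        let d : ℚ := 1 - 2 * a / ((m + 1 : ℕ) : ℚ)
        let e : ℚ := a - 4 * d / ((m + 1 : ℕ) : ℚ)
        let f : ℚ := b - 4 * c / ((m + 1 : ℕ) : ℚ)
        let g : ℚ := d - 6 * e / ((m + 1 : ℕ) : ℚ)
        let M : ℚ := max f g
        let Zl : ℚ := 1 + 2 * a ^ (16 * 16) + 2 * c ^ (16 * 16)
        let Zh : ℚ := 1 + 2 * b ^ (16 * 16) + 2 * d ^ (16 * 16) + M ^ (16 * 16 - 1) * ((2719 / 1000 : ℚ) ^ (m + 1))
        let Nl : ℚ := a + a ^ (16 * 16 - 1) * (1 + c) + c ^ (16 * 16 - 1) * (a + e)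
        let Nh : ℚ := b + b ^ (16 * 16 - 1) * (1 + d) + d ^ (16 * 16 - 1) * (b + f) + M ^ (16 * 16 - 2) * ((2719 / 1000 : ℚ) ^ (m + 1))
        let Pl : ℚ := a ^ 2 + 2 * a ^ (16 * 16 - 2) * ((1 + c) / 2) ^ 2 + 2 * c ^ (16 * 16 - 2) * ((a + e) / 2) ^ 2
        let Ph : ℚ := b ^ 2 + 2 * b ^ (16 * 16 - 2) * ((1 + d) / 2) ^ 2 + 2 * d ^ (16 * 16 - 2) * ((b + f) / 2) ^ 2 +
          M ^ (16 * 16 - 3) * ((2719 / 1000 : ℚ) ^ (m + 1))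
        let Sl : ℚ := (1 + c) / 2 + 2 * a ^ (16 * 16 - 1) * ((3 * a + e) / 4) +
          2 * c ^ (16 * 16 - 1) * ((1 + 2 * c) / 4)
        let Sh : ℚ := (1 + d) / 2 + 2 * b ^ (16 * 16 - 1) * ((3 * b + f) / 4) +
          2 * d ^ (16 * 16 - 1) * ((1 + 2 * d + g) / 4) + M ^ (16 * 16 - 2) * ((2719 / 1000 : ℚ) ^ (m + 1))
        decide (0 < a) && decide (0 ≤ c) && decide (0 ≤ e) &&
          decide (lo ≤ Sl / (((16 * 16 : ℕ) : ℚ) * Zh) + (1 - 1 / ((16 * 16 : ℕ) : ℚ)) * (Pl / Zh) - (Nh / Zl) ^ 2) &&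
          decide (Sh / (((16 * 16 : ℕ) : ℚ) * Zl) + (1 - 1 / ((16 * 16 : ℕ) : ℚ)) * (Ph / Zl) - (Nl / Zh) ^ 2 ≤ hi) : Bool) = true)) :
    ((lo : ℚ) : ℝ) ≤
      u1WilsonExpect univ (torusInc e) (fun _ => ((m + 1 : ℕ) : ℝ))
          (fun θ => ((∑ x, Real.cos (u1PlaqAngle (torusInc e) x θ)) / ((16 * 16 : ℕ) : ℝ)) ^ 2) -
        u1WilsonExpect univ (torusInc e) (fun _ => ((m + 1 : ℕ) : ℝ))
          (fun θ => (∑ x, Real.cos (u1PlaqAngle (torusInc e) x θ)) / ((16 * 16 : ℕ) : ℝ)) ^ 2 ∧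
    u1WilsonExpect univ (torusInc e) (fun _ => ((m + 1 : ℕ) : ℝ))
          (fun θ => ((∑ x, Real.cos (u1PlaqAngle (torusInc e) x θ)) / ((16 * 16 : ℕ) : ℝ)) ^ 2) -
        u1WilsonExpect univ (torusInc e) (fun _ => ((m + 1 : ℕ) : ℝ))
          (fun θ => (∑ x, Real.cos (u1PlaqAngle (torusInc e) x θ)) / ((16 * 16 : ℕ) : ℝ)) ^ 2 ≤
      ((hi : ℚ) : ℝ) := by
  have hβ : (0 : ℝ) < (((m + 1 : ℕ) : ℚ) : ℝ) := by positivity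
  have hE : Real.exp ((((m + 1 : ℕ) : ℚ) : ℝ)) ≤ ((((2719 / 1000 : ℚ) ^ (m + 1) : ℚ)) : ℝ) := by
    push_cast
    have := exp_nat_le_pow (m + 1)
    push_cast at this
    exact this
  have hs := torusVariance_mem_Icc_of_check (V := 16 * 16) (by norm_num) hu hr hβ hE
  rw [torus_u1WilsonExpect_plaquetteAverage_variance]
  push_cast at hs ⊢
  exact hs

end Torus16

end Summit.Ventures.LatticeQCDFlow.Scoring
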